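import Summits.QuantumFields.YangMills.Theorems.BalabanLadderIRcofEquipartitionSeamCodeHook
import HarnessLib

/-!
# Equipartition seam, S4ᵛ for THICK species (crit-3 P1″ answered): peeling a dressed insertion of temporal
# thickness `r` costs equipartition at the SHORTER extent `t − r` plus the VACUUM thermal slack — matrix level, 0 sorry

Crux `IRcof` (stmt-QuantumFields-26930), N_cof side, LINE 1 «equipartition_seam» (skeleton rev 7, crux write
b786d9ea556a; custody ym-ir-idea-22).  Companion of `Lines/equipartition_seam_FluxFourier.lean` (flux-domination adapter)
and of the landed engine `centreFourier_traceBlindness_opNorm` (`Theorems/…CodeHook.lean`, p666431).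

## The question (crit-3 g5, P1″)
The consumer chain `MixUnits → CoverGapCof → IRnscCof` quantifies `∀ A B : YMSpecies G` — bounded MEASURABLE gauge-invariant
cylinder functions of finite support, in general occupying `r ≥ 1` consecutive time slices (already one temporal plaquette
has `r = 1`).  Restricting S4ᵛ (`EBlindUnitsV`) to the single-slice product algebra 𝒫 is therefore NOT available: electric
blindness is owed for thick species.  The landed engine treats an insertion `A` sitting next to the FULL transfer power
`X = 𝕋^t` (`t = 2S+1`); a species of thickness `r` is, in the transfer reading, a dressed insertion `𝔹_A` replacing `r` of
the `t` kernel steps: `W_x = tr(Ω_x 𝕋^{t−r} 𝔹_A)`, `Z_x = tr(Ω_x 𝕋^{t})`, with `‖𝔹_A‖ ≤ ‖A‖_∞ ‖𝕋^r‖` (the kernel of `𝔹_A` is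
dominated entrywise by `‖A‖_∞` times the kernel of `𝕋^r`) and NO positivity or commutation property of `𝔹_A` (crit-3's
two-state witness l.1566: `𝕋M₁𝕋M₂𝕋 ⋠ K𝕋³`, so no Loewner shortcut exists for `r ≥ 1`).

## The mechanism (PEELING) and its exact price — all theorems below are proved
* §1 `insertion_fluxUniform` — for ANY matrix `B`: equipartition of the twisted traces of `X ⪰ 0` at defect `δ`
  forces `‖tr(Ω_x X B) − tr(X B)‖ ≤ 2|α|·‖B‖·δ·Re tr X` (Fourier over the characters of `α`, positivity of `P_ψ X`,
  `‖tr(P_ψ X B)‖ ≤ ‖B‖ Re tr(P_ψ X)`; the engine's inner step, exported with the operator norm).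
* §2 `pairBound_of_uniform` — bookkeeping: flux-uniform numerators + equipartitioned denominators ⇒ the EBLIND cross
  difference `W_x Z_y − W_y Z_x` is `O((ε + wδ) Z₀)`.
* §3 ★ `eblind_thick` — with `X = 𝕋^{t−r}`, `Y = 𝕋^{t}` (two PSD matrices commuting with the twists), equipartition of
  BOTH at defect `δ ≤ 1`, and the single SLACK hypothesis `‖B‖·Re tr X ≤ K·Re tr Y`:
  `‖tr(Ω_x X B)·tr(Ω_y Y) − tr(Ω_y X B)·tr(Ω_x Y)‖ ≤ (8|α| + 2)·K·δ·(Re tr Y)²`;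
  `eblind_thick_re` — the same with `4·Re tr(Ω_x Y)·Re tr(Ω_y Y)` on the right (`δ ≤ 1/2`; the `p_z p_w` shape of
  `EBlindUnitOn`).  RATE PRESERVED (one factor `δ`), constant linear in `K`.
* §4 `eblind_thick_pow` — the transfer reading `X = T^s`, `Y = T^{s+r}`, `‖B‖ ≤ a‖T^r‖`: the slack hypothesis becomes the
  VACUUM THERMAL SLACK `‖T^r‖·Re tr T^s ≤ C·Re tr T^{s+r}` and `K = aC`; `re_trace_pow_add_le` — the converse inequality
  `Re tr T^{s+r} ≤ ‖T^r‖ Re tr T^s` ALWAYS holds, so the slack asks only that this trivial bound be sharp up to `C`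
  (`C ≥ 1`; in lattice words `λ₊^r Z(L³×(t−r)) ≤ C·Z(L³×t)`, i.e. `tr 𝕋̂^{t−r} ≤ C tr 𝕋̂^{t}` for the normalised transfer
  matrix: an `O(1)` Stefan–Boltzmann free energy on the near-cubic torus, NOT a gap statement; false only far from the
  cubic regime, hence the aspect window `r ≤ t/4` in the proposed stub).
* §5 `eblind_sameExtent` — `r = 0` (thin species, `X = Y`, `K = ‖B‖`): no slack at all, the engine's regime (R1 agreed).

## What this settles and what it leaves (HONEST)
SETTLED (matrix level, sorry-free): EQUI at the two extents `t−r, t` + vacuum slack ⇒ EBLIND for a thickness-`r` species at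
rate 1 with constant `(8|α|+2)·‖A‖_∞·C`.  CORRECTION of this seat's g5 note: the price is NOT a flux-sector thermal slack
(crit-3 l.1566 rightly objected that sector-wise conversion between extents carries `e^{E_ψ r}`); no flux-sector quantity is
ever moved between extents here — only the VACUUM trace is (slack `T`), and the flux sectors are controlled at each extent
by equipartition there.  OWED (lattice level, the proposed rev-8 stubs, to be typed): S3ʷ = EQUI on the near-cubic window
`L³ × s`, `s ∈ [3L/4, L]` (same confinement content as S3, which is its `s = L` case); T = vacuum thermal slack on that
window; D = the transfer dictionary of the split-weight (`TwistSplitWeight`, positive type ⇒ RP) cover theory: sector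
integrals of pulled-back species = twisted traces with dressed insertions dominated by `‖A‖_∞‖𝕋^r‖`; N = sharp↔split
sector noise (`c(β)β → ∞`).  Nothing here is EQUI, PSC, N_cof, `IRcof`, `IR`, or the Clay Yang–Mills mass gap (NOT proved
anywhere in this tree; R4 closes only the conditional finite-𝕋⁴ rung `BalabanLadder.UV`); census row 47 stays PWP,
mechanism count 0.  Attribution: ym-ir-idea-22 g6 (author); engine p164278 ∕ p664144 ∕ p666431 (cited by name).
-/

set_option autoImplicit false

noncomputable section

namespace Summit.QuantumFields.YangMills.Cruxes.IRcof.EquipartitionSeam.ThickSpecies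

open scoped ComplexOrder MatrixOrder Matrix.Norms.L2Operator
open Matrix
open Summit.QuantumFields.YangMills.Theorems.NonSimplyConnectedLatticeGap

/-! ## §0 Two facts on PSD traces -/

section PSDTrace

variable {n : Type*} [Fintype n]

/-- The trace of a PSD matrix is the real number `Re tr X`. -/
theorem trace_eq_re {X : Matrix n n ℂ} (hX : X.PosSemidef) : X.trace = ((X.trace.re : ℝ) : ℂ) := by
  obtain ⟨_, him⟩ := Complex.nonneg_iff.mp hX.trace_nonneg
  exact Complex.ext (by simp) (by simp [← him])

/-- `Re tr X ≥ 0` for `X ⪰ 0`. -/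
theorem trace_re_nonneg {X : Matrix n n ℂ} (hX : X.PosSemidef) : 0 ≤ X.trace.re :=
  (Complex.nonneg_iff.mp hX.trace_nonneg).1

/-- `‖tr X‖ = Re tr X` for `X ⪰ 0`. -/
theorem norm_trace_eq_re {X : Matrix n n ℂ} (hX : X.PosSemidef) : ‖X.trace‖ = X.trace.re := by
  rw [trace_eq_re hX, Complex.norm_real, Real.norm_eq_abs, abs_of_nonneg (trace_re_nonneg hX), Complex.ofReal_re]

end PSDTrace

/-! ## §1 Flux-uniformity of an arbitrary insertion next to an equipartitioned PSD block -/

section FluxUniform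

variable {n : Type*} [Fintype n] [DecidableEq n]
variable {α : Type*} [AddCommGroup α] [Fintype α] [DecidableEq α]

/-- **Peeling, step 1 (flux-uniformity of a dressed insertion).**  `U` a unitary action of the finite abelian group `α`
commuting with `X ⪰ 0`, equipartition `‖tr(U_x X) − tr X‖ ≤ δ Re tr X` (`δ ≥ 0`), `B` ANY matrix.  Then
`‖tr(U_x X B) − tr(X B)‖ ≤ 2|α|·‖B‖·δ·Re tr X` for every `x`.
Proof: `tr(U_x X B) = Σ_ψ ψ(x) tr(P_ψ X B)`; for `ψ ≠ 0`, `‖tr(P_ψ X B)‖ ≤ ‖B‖ Re tr(P_ψ X) ≤ ‖B‖ δ Re tr X`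
(`P_ψ X ⪰ 0`; equipartition kills the non-trivial fluxes); the `ψ = 0` term cancels. -/
theorem insertion_fluxUniform (U : α → Matrix n n ℂ) (X B : Matrix n n ℂ) (δ : ℝ) (hU0 : U 0 = 1)
    (hUadd : ∀ x y : α, U (x + y) = U x * U y) (hUstar : ∀ x : α, (U x)ᴴ = U (-x)) (hX : X.PosSemidef)
    (hUX : ∀ x : α, U x * X = X * U x) (hδ : 0 ≤ δ)
    (hequi : ∀ x : α, ‖(U x * X).trace - X.trace‖ ≤ δ * X.trace.re) (x : α) :
    ‖(U x * X * B).trace - (X * B).trace‖ ≤ 2 * (Fintype.card α : ℝ) * ‖B‖ * δ * X.trace.re := by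
  set P : AddChar α ℂ → Matrix n n ℂ := fun ψ => (Fintype.card α : ℂ)⁻¹ • ∑ b : α, ψ (-b) • U b with hPdef
  have hPX : ∀ ψ, (P ψ * X).PosSemidef := fun ψ =>
    posSemidef_proj_mul (charProj_isHermitian U hUstar ψ) (charProj_mul_self U hUadd ψ) (charProj_comm U X hUX ψ) hX
  have hBψ : ∀ ψ, ‖(P ψ * X * B).trace‖ ≤ ‖B‖ * (P ψ * X).trace.re := fun ψ =>
    norm_trace_mul_le_opNorm (hPX ψ) B
  have hZψ : ∀ ψ : AddChar α ℂ, ψ ≠ 0 → ‖(P ψ * X).trace‖ ≤ δ * X.trace.re := fun ψ hψ =>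
    charProj_trace_le_of_equipartition U X ψ hψ δ hequi
  have hexp : ∀ y : α, (U y * X * B).trace = ∑ ψ : AddChar α ℂ, ψ y * (P ψ * X * B).trace := by
    intro y
    conv_lhs => rw [← sum_char_smul_charProj U y]
    rw [Finset.sum_mul, Finset.sum_mul, Matrix.trace_sum]
    refine Finset.sum_congr rfl fun ψ _ => ?_
    rw [Matrix.smul_mul, Matrix.smul_mul, Matrix.trace_smul, smul_eq_mul]
  have hZ0re : 0 ≤ X.trace.re := trace_re_nonneg hX
  have h0 : (X * B).trace = ∑ ψ : AddChar α ℂ, (P ψ * X * B).trace := by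
    have := hexp 0
    simpa [hU0] using this
  rw [hexp x, h0, ← Finset.sum_sub_distrib]
  calc ‖∑ ψ : AddChar α ℂ, (ψ x * (P ψ * X * B).trace - (P ψ * X * B).trace)‖
      ≤ ∑ ψ : AddChar α ℂ, ‖ψ x * (P ψ * X * B).trace - (P ψ * X * B).trace‖ := norm_sum_le _ _
    _ ≤ ∑ ψ : AddChar α ℂ, 2 * ‖B‖ * δ * X.trace.re := by
        refine Finset.sum_le_sum fun ψ _ => ?_
        by_cases hψ : ψ = 0
        · subst hψ
          simp only [AddChar.zero_apply, one_mul, sub_self, norm_zero]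
          positivity
        · rw [← sub_one_mul, norm_mul]
          have h1 : ‖ψ x - 1‖ ≤ 2 := by
            calc ‖ψ x - 1‖ ≤ ‖ψ x‖ + ‖(1 : ℂ)‖ := norm_sub_le _ _
              _ = 2 := by rw [AddChar.norm_apply, norm_one]; norm_num
          have h2 : ‖(P ψ * X * B).trace‖ ≤ ‖B‖ * (δ * X.trace.re) :=
            (hBψ ψ).trans (mul_le_mul_of_nonneg_left ((Complex.re_le_norm _).trans (hZψ ψ hψ)) (norm_nonneg B))
          calc ‖ψ x - 1‖ * ‖(P ψ * X * B).trace‖ ≤ 2 * (‖B‖ * (δ * X.trace.re)) :=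
                mul_le_mul h1 h2 (norm_nonneg _) (by norm_num)
            _ = 2 * ‖B‖ * δ * X.trace.re := by ring
    _ = 2 * (Fintype.card α : ℝ) * ‖B‖ * δ * X.trace.re := by
        rw [Finset.sum_const, Finset.card_univ, AddChar.card_eq, nsmul_eq_mul]
        ring

/-- The untwisted insertion is bounded by the operator norm: `‖tr(X B)‖ ≤ ‖B‖ Re tr X` (landed, renamed for the reading
`w = ‖B‖ Re tr X` of §2). -/
theorem norm_insertion_le (X B : Matrix n n ℂ) (hX : X.PosSemidef) : ‖(X * B).trace‖ ≤ ‖B‖ * X.trace.re :=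
  norm_trace_mul_le_opNorm hX B

end FluxUniform

/-! ## §2 Bookkeeping: uniform numerators and equipartitioned denominators give the EBLIND cross difference -/

section PairBound

variable {α : Type*}

/-- **Cross-difference bookkeeping.**  If `‖W_x − W₀‖ ≤ ε` for all `x`, `‖W₀‖ ≤ w`, and `‖Z_x − Z₀‖ ≤ δ Z₀` for all `x`
(`Z₀ ≥ 0` real), then `‖W_x Z_y − W_y Z_x‖ ≤ 2ε(1+δ)Z₀ + 2wδZ₀`
(`W_x Z_y − W_y Z_x = (W_x − W₀)Z_y − (W_y − W₀)Z_x + W₀(Z_y − Z_x)`). -/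
theorem pairBound_of_uniform (W Z : α → ℂ) (W₀ : ℂ) (Z₀ ε w δ : ℝ) (hZ₀ : 0 ≤ Z₀)
    (hW : ∀ x, ‖W x - W₀‖ ≤ ε) (hw : ‖W₀‖ ≤ w) (hZ : ∀ x, ‖Z x - (Z₀ : ℂ)‖ ≤ δ * Z₀) (x y : α) :
    ‖W x * Z y - W y * Z x‖ ≤ 2 * ε * ((1 + δ) * Z₀) + 2 * w * δ * Z₀ := by
  have hε : 0 ≤ ε := (norm_nonneg _).trans (hW x)
  have hw0 : 0 ≤ w := (norm_nonneg _).trans hw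
  have hδZ : 0 ≤ δ * Z₀ := (norm_nonneg _).trans (hZ x)
  have hZn : ∀ u, ‖Z u‖ ≤ (1 + δ) * Z₀ := fun u => by
    have hsplit : Z u = (Z u - (Z₀ : ℂ)) + (Z₀ : ℂ) := by ring
    calc ‖Z u‖ = ‖(Z u - (Z₀ : ℂ)) + (Z₀ : ℂ)‖ := by rw [← hsplit]
      _ ≤ ‖Z u - (Z₀ : ℂ)‖ + ‖(Z₀ : ℂ)‖ := norm_add_le _ _
      _ ≤ δ * Z₀ + Z₀ := by
          rw [Complex.norm_real, Real.norm_eq_abs, abs_of_nonneg hZ₀]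
          exact add_le_add (hZ u) le_rfl
      _ = (1 + δ) * Z₀ := by ring
  have hZd : ‖Z y - Z x‖ ≤ 2 * δ * Z₀ := by
    have hsplit : Z y - Z x = (Z y - (Z₀ : ℂ)) - (Z x - (Z₀ : ℂ)) := by ring
    calc ‖Z y - Z x‖ = ‖(Z y - (Z₀ : ℂ)) - (Z x - (Z₀ : ℂ))‖ := by rw [← hsplit]
      _ ≤ ‖Z y - (Z₀ : ℂ)‖ + ‖Z x - (Z₀ : ℂ)‖ := norm_sub_le _ _
      _ ≤ δ * Z₀ + δ * Z₀ := add_le_add (hZ y) (hZ x)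
      _ = 2 * δ * Z₀ := by ring
  have key : W x * Z y - W y * Z x = (W x - W₀) * Z y - (W y - W₀) * Z x + W₀ * (Z y - Z x) := by ring
  rw [key]
  calc ‖(W x - W₀) * Z y - (W y - W₀) * Z x + W₀ * (Z y - Z x)‖
      ≤ ‖(W x - W₀) * Z y - (W y - W₀) * Z x‖ + ‖W₀ * (Z y - Z x)‖ := norm_add_le _ _
    _ ≤ ‖(W x - W₀) * Z y‖ + ‖(W y - W₀) * Z x‖ + ‖W₀ * (Z y - Z x)‖ :=
        add_le_add (norm_sub_le _ _) le_rfl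
    _ = ‖W x - W₀‖ * ‖Z y‖ + ‖W y - W₀‖ * ‖Z x‖ + ‖W₀‖ * ‖Z y - Z x‖ := by simp only [norm_mul]
    _ ≤ ε * ((1 + δ) * Z₀) + ε * ((1 + δ) * Z₀) + w * (2 * δ * Z₀) := by
        have hZ0' : 0 ≤ (1 + δ) * Z₀ := (norm_nonneg _).trans (hZn x)
        refine add_le_add (add_le_add ?_ ?_) ?_
        · exact mul_le_mul (hW x) (hZn y) (norm_nonneg _) hε
        · exact mul_le_mul (hW y) (hZn x) (norm_nonneg _) hε
        · exact mul_le_mul hw hZd (norm_nonneg _) hw0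
    _ = 2 * ε * ((1 + δ) * Z₀) + 2 * w * δ * Z₀ := by ring

end PairBound

/-! ## §3 ★ EBLIND for a thick species from equipartition at two extents and the vacuum slack -/

section Thick

variable {n : Type*} [Fintype n] [DecidableEq n]
variable {α : Type*} [AddCommGroup α] [Fintype α] [DecidableEq α]

/-- **★ Peeling theorem (electric blindness for a thick species, matrix level).**  `U` a unitary action of the finite
abelian `α` (electric twists) commuting with the PSD block `X` (read `𝕋_w^{t−r}`), a second PSD block `Y` (read `𝕋_w^{t}`;
no commutation with `Y` is used); equipartition
of the twisted traces of BOTH at defect `0 ≤ δ ≤ 1`; `B` ANY matrix (read: the dressed insertion of a species of temporal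
thickness `r`) subject to the single slack hypothesis `‖B‖·Re tr X ≤ K·Re tr Y` (read: `‖𝔹_A‖ ≤ ‖A‖_∞‖𝕋^r‖` and
`‖𝕋^r‖ tr 𝕋^{t−r} ≤ C tr 𝕋^{t}`, `K = ‖A‖_∞ C`).  Then for all twists `x, y`:
`‖tr(U_x X B)·tr(U_y Y) − tr(U_y X B)·tr(U_x Y)‖ ≤ (8|α| + 2)·K·δ·(Re tr Y)²` — RATE PRESERVED. -/
theorem eblind_thick (U : α → Matrix n n ℂ) (X Y B : Matrix n n ℂ) (δ K : ℝ) (hU0 : U 0 = 1)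
    (hUadd : ∀ x y : α, U (x + y) = U x * U y) (hUstar : ∀ x : α, (U x)ᴴ = U (-x)) (hX : X.PosSemidef)
    (hY : Y.PosSemidef) (hUX : ∀ x : α, U x * X = X * U x) (hδ : 0 ≤ δ)
    (hδ1 : δ ≤ 1) (hequiX : ∀ x : α, ‖(U x * X).trace - X.trace‖ ≤ δ * X.trace.re)
    (hequiY : ∀ x : α, ‖(U x * Y).trace - Y.trace‖ ≤ δ * Y.trace.re)
    (hslack : ‖B‖ * X.trace.re ≤ K * Y.trace.re) (x y : α) :
    ‖(U x * X * B).trace * (U y * Y).trace - (U y * X * B).trace * (U x * Y).trace‖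
      ≤ (8 * (Fintype.card α : ℝ) + 2) * K * δ * Y.trace.re ^ 2 := by
  have hY0 : 0 ≤ Y.trace.re := trace_re_nonneg hY
  have hX0 : 0 ≤ X.trace.re := trace_re_nonneg hX
  have hW : ∀ u : α, ‖(U u * X * B).trace - (X * B).trace‖ ≤ 2 * (Fintype.card α : ℝ) * ‖B‖ * δ * X.trace.re :=
    insertion_fluxUniform U X B δ hU0 hUadd hUstar hX hUX hδ hequiX
  have hw : ‖(X * B).trace‖ ≤ ‖B‖ * X.trace.re := norm_insertion_le X B hX
  have hZ : ∀ u : α, ‖(U u * Y).trace - ((Y.trace.re : ℝ) : ℂ)‖ ≤ δ * Y.trace.re := fun u => by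
    rw [← trace_eq_re hY]; exact hequiY u
  have h := pairBound_of_uniform (fun u => (U u * X * B).trace) (fun u => (U u * Y).trace) (X * B).trace
    Y.trace.re (2 * (Fintype.card α : ℝ) * ‖B‖ * δ * X.trace.re) (‖B‖ * X.trace.re) δ hY0 hW hw hZ x y
  refine h.trans ?_
  have hcard : (0 : ℝ) ≤ Fintype.card α := Nat.cast_nonneg _
  have hBX : 0 ≤ ‖B‖ * X.trace.re := mul_nonneg (norm_nonneg _) hX0
  -- substitute the slack `‖B‖ Re tr X ≤ K Re tr Y` and `1 + δ ≤ 2`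
  calc 2 * (2 * (Fintype.card α : ℝ) * ‖B‖ * δ * X.trace.re) * ((1 + δ) * Y.trace.re)
        + 2 * (‖B‖ * X.trace.re) * δ * Y.trace.re
      = (4 * (Fintype.card α : ℝ) * (1 + δ) + 2) * δ * Y.trace.re * (‖B‖ * X.trace.re) := by ring
    _ ≤ (4 * (Fintype.card α : ℝ) * 2 + 2) * δ * Y.trace.re * (K * Y.trace.re) := by
        have h1 : (4 * (Fintype.card α : ℝ) * (1 + δ) + 2) ≤ 4 * (Fintype.card α : ℝ) * 2 + 2 := by nlinarith
        have h2 : 0 ≤ (4 * (Fintype.card α : ℝ) * (1 + δ) + 2) := by positivity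
        have h3 : 0 ≤ δ * Y.trace.re := mul_nonneg hδ hY0
        calc (4 * (Fintype.card α : ℝ) * (1 + δ) + 2) * δ * Y.trace.re * (‖B‖ * X.trace.re)
            = (4 * (Fintype.card α : ℝ) * (1 + δ) + 2) * (δ * Y.trace.re) * (‖B‖ * X.trace.re) := by ring
          _ ≤ (4 * (Fintype.card α : ℝ) * 2 + 2) * (δ * Y.trace.re) * (K * Y.trace.re) := by
              gcongr
          _ = (4 * (Fintype.card α : ℝ) * 2 + 2) * δ * Y.trace.re * (K * Y.trace.re) := by ring
    _ = (8 * (Fintype.card α : ℝ) + 2) * K * δ * Y.trace.re ^ 2 := by ring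

/-- **The `p_z p_w` shape** (`δ ≤ 1/2`): since `Re tr(U_x Y) ≥ (1 − δ) Re tr Y ≥ ½ Re tr Y`, the bound of `eblind_thick`
reads `≤ 4(8|α| + 2)·K·δ·Re tr(U_x Y)·Re tr(U_y Y)` — literally `|p_w W_z − p_z W_w| ≤ C' δ p_z p_w` after normalisation,
the shape of `EBlindUnitOn` with `δ = e^{−(2S+1)}` and `C' = 4(8|α|+2)‖A‖_∞ C`. -/
theorem eblind_thick_re (U : α → Matrix n n ℂ) (X Y B : Matrix n n ℂ) (δ K : ℝ) (hU0 : U 0 = 1)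
    (hUadd : ∀ x y : α, U (x + y) = U x * U y) (hUstar : ∀ x : α, (U x)ᴴ = U (-x)) (hX : X.PosSemidef)
    (hY : Y.PosSemidef) (hUX : ∀ x : α, U x * X = X * U x) (hδ : 0 ≤ δ)
    (hδ2 : δ ≤ 1 / 2) (hK : 0 ≤ K) (hequiX : ∀ x : α, ‖(U x * X).trace - X.trace‖ ≤ δ * X.trace.re)
    (hequiY : ∀ x : α, ‖(U x * Y).trace - Y.trace‖ ≤ δ * Y.trace.re)
    (hslack : ‖B‖ * X.trace.re ≤ K * Y.trace.re) (x y : α) :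
    ‖(U x * X * B).trace * (U y * Y).trace - (U y * X * B).trace * (U x * Y).trace‖
      ≤ 4 * ((8 * (Fintype.card α : ℝ) + 2) * K * δ) * (U x * Y).trace.re * (U y * Y).trace.re := by
  have hY0 : 0 ≤ Y.trace.re := trace_re_nonneg hY
  have h := eblind_thick U X Y B δ K hU0 hUadd hUstar hX hY hUX hδ (hδ2.trans (by norm_num)) hequiX hequiY
    hslack x y
  -- the twisted denominators are at least half the untwisted one
  have hlow : ∀ u : α, Y.trace.re ≤ 2 * (U u * Y).trace.re := fun u => by
    have h1 : (Y.trace - (U u * Y).trace).re ≤ ‖Y.trace - (U u * Y).trace‖ := Complex.re_le_norm _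
    have h2 : ‖Y.trace - (U u * Y).trace‖ ≤ δ * Y.trace.re := by rw [norm_sub_rev]; exact hequiY u
    have h3 : (Y.trace - (U u * Y).trace).re = Y.trace.re - (U u * Y).trace.re := Complex.sub_re _ _
    nlinarith
  refine h.trans ?_
  have hc : 0 ≤ (8 * (Fintype.card α : ℝ) + 2) * K * δ := by positivity
  have hsq : Y.trace.re ^ 2 ≤ 4 * ((U x * Y).trace.re * (U y * Y).trace.re) := by
    have hx := hlow x
    have hy := hlow y
    have hx0 : 0 ≤ (U x * Y).trace.re := by linarith
    nlinarith [mul_le_mul hx hy hY0 (by linarith)]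
  calc (8 * (Fintype.card α : ℝ) + 2) * K * δ * Y.trace.re ^ 2
      ≤ (8 * (Fintype.card α : ℝ) + 2) * K * δ * (4 * ((U x * Y).trace.re * (U y * Y).trace.re)) :=
        mul_le_mul_of_nonneg_left hsq hc
    _ = 4 * ((8 * (Fintype.card α : ℝ) + 2) * K * δ) * (U x * Y).trace.re * (U y * Y).trace.re := by ring

end Thick

/-! ## §4 The transfer reading: powers of one PSD matrix, domination, and the vacuum thermal slack -/

section Powers

variable {n : Type*} [Fintype n] [DecidableEq n]
variable {α : Type*} [AddCommGroup α] [Fintype α] [DecidableEq α]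

/-- **The trivial direction of the slack.**  For `T ⪰ 0`: `Re tr T^{s+r} ≤ ‖T^r‖·Re tr T^s` always (`T^{s+r} = T^s T^r`
and `‖tr(T^s T^r)‖ ≤ ‖T^r‖ Re tr T^s`).  So the vacuum thermal slack `‖T^r‖ Re tr T^s ≤ C Re tr T^{s+r}` of
`eblind_thick_pow` says exactly that this trivial bound is sharp up to the factor `C ≥ 1` — for the normalised transfer
matrix `𝕋̂ = 𝕋/λ₊`: `tr 𝕋̂^{t−r} ≤ C tr 𝕋̂^{t}`, an `O(1)` thermal multiplicity on the near-cubic torus. -/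
theorem re_trace_pow_add_le (T : Matrix n n ℂ) (hT : T.PosSemidef) (s r : ℕ) :
    (T ^ (s + r)).trace.re ≤ ‖T ^ r‖ * (T ^ s).trace.re := by
  rw [pow_add]
  exact (Complex.re_le_norm _).trans (norm_trace_mul_le_opNorm (hT.pow s) (T ^ r))

/-- **★ Peeling in the transfer reading.**  `T ⪰ 0` (the split-weight transfer matrix `𝕋_w`), `U` a unitary action of
`α` commuting with `T`, natural numbers `s` (free extent) and `r` (thickness of the species), equipartition of the
twisted traces of `T^s` AND of `T^{s+r}` at defect `0 ≤ δ ≤ 1`, an insertion `B` DOMINATED as `‖B‖ ≤ a‖T^r‖`, and the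
VACUUM THERMAL SLACK `‖T^r‖·Re tr T^s ≤ C·Re tr T^{s+r}`.  Then
`‖tr(U_x T^s B) tr(U_y T^{s+r}) − tr(U_y T^s B) tr(U_x T^{s+r})‖ ≤ (8|α|+2)·aC·δ·(Re tr T^{s+r})²`. -/
theorem eblind_thick_pow (U : α → Matrix n n ℂ) (T B : Matrix n n ℂ) (s r : ℕ) (δ a C : ℝ) (hU0 : U 0 = 1)
    (hUadd : ∀ x y : α, U (x + y) = U x * U y) (hUstar : ∀ x : α, (U x)ᴴ = U (-x)) (hT : T.PosSemidef)
    (hUT : ∀ x : α, U x * T = T * U x) (hδ : 0 ≤ δ) (hδ1 : δ ≤ 1)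
    (hequiS : ∀ x : α, ‖(U x * T ^ s).trace - (T ^ s).trace‖ ≤ δ * (T ^ s).trace.re)
    (hequiT : ∀ x : α, ‖(U x * T ^ (s + r)).trace - (T ^ (s + r)).trace‖ ≤ δ * (T ^ (s + r)).trace.re)
    (ha : 0 ≤ a) (hB : ‖B‖ ≤ a * ‖T ^ r‖)
    (hslack : ‖T ^ r‖ * (T ^ s).trace.re ≤ C * (T ^ (s + r)).trace.re) (x y : α) :
    ‖(U x * T ^ s * B).trace * (U y * T ^ (s + r)).trace - (U y * T ^ s * B).trace * (U x * T ^ (s + r)).trace‖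
      ≤ (8 * (Fintype.card α : ℝ) + 2) * (a * C) * δ * (T ^ (s + r)).trace.re ^ 2 := by
  have hXs : (T ^ s).PosSemidef := hT.pow s
  have hXt : (T ^ (s + r)).PosSemidef := hT.pow (s + r)
  have hUs : ∀ x : α, U x * T ^ s = T ^ s * U x := fun x => (Commute.pow_right (hUT x) s : Commute (U x) (T ^ s))
  have hs0 : 0 ≤ (T ^ s).trace.re := trace_re_nonneg hXs
  have hslack' : ‖B‖ * (T ^ s).trace.re ≤ (a * C) * (T ^ (s + r)).trace.re := by
    calc ‖B‖ * (T ^ s).trace.re ≤ (a * ‖T ^ r‖) * (T ^ s).trace.re := mul_le_mul_of_nonneg_right hB hs0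
      _ = a * (‖T ^ r‖ * (T ^ s).trace.re) := by ring
      _ ≤ a * (C * (T ^ (s + r)).trace.re) := mul_le_mul_of_nonneg_left hslack ha
      _ = (a * C) * (T ^ (s + r)).trace.re := by ring
  exact eblind_thick U (T ^ s) (T ^ (s + r)) B δ (a * C) hU0 hUadd hUstar hXs hXt hUs hδ hδ1 hequiS hequiT
    hslack' x y

end Powers

/-! ## §5 Sanity: thickness `0` (thin species) needs no slack — the engine's regime -/

section Thin

variable {n : Type*} [Fintype n] [DecidableEq n]
variable {α : Type*} [AddCommGroup α] [Fintype α] [DecidableEq α]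

/-- **Thin species (`X = Y`, `K = ‖B‖`).**  With a single PSD block the slack hypothesis is `le_rfl` and `eblind_thick`
returns the engine's bound up to the constant: `‖tr(U_x X B) tr(U_y X) − tr(U_y X B) tr(U_x X)‖ ≤ (8|α|+2)‖B‖δ(Re tr X)²`
(crit-3 R1: single-slice species need S3 only). -/
theorem eblind_sameExtent (U : α → Matrix n n ℂ) (X B : Matrix n n ℂ) (δ : ℝ) (hU0 : U 0 = 1)
    (hUadd : ∀ x y : α, U (x + y) = U x * U y) (hUstar : ∀ x : α, (U x)ᴴ = U (-x)) (hX : X.PosSemidef)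
    (hUX : ∀ x : α, U x * X = X * U x) (hδ : 0 ≤ δ) (hδ1 : δ ≤ 1)
    (hequi : ∀ x : α, ‖(U x * X).trace - X.trace‖ ≤ δ * X.trace.re) (x y : α) :
    ‖(U x * X * B).trace * (U y * X).trace - (U y * X * B).trace * (U x * X).trace‖
      ≤ (8 * (Fintype.card α : ℝ) + 2) * ‖B‖ * δ * X.trace.re ^ 2 :=
  eblind_thick U X X B δ ‖B‖ hU0 hUadd hUstar hX hX hUX hδ hδ1 hequi hequi le_rfl x y

end Thin

/-! ## §6 The HÖLDER route's consumer: flux SUPPRESSION of the numerators (function level, no matrices)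

Route (H) (located, not typed — it needs Schatten-`p` Hölder with fractional powers, absent from Mathlib and the tree at
matrix level): `|Ŵ_t(ψ)| = |tr(P_ψ 𝕋^{t−r} 𝔹)| ≤ ‖P_ψ𝕋^{t−r}‖_{t/(t−r)} ‖𝔹‖_{t/r} ≤ e^{r} C^{r/t} ‖A‖_∞ · δ · Z_t` uses
equipartition at the FULL extent `t` only, plus the vacuum slack between the even extent `2⌊t/2r⌋r` and `t`.  Its output is
a flux-SUPPRESSION bound on the numerators, `‖Σ_b ψ(−b) W_b‖ ≤ ε` for `ψ ≠ 0` — NOT the flux-domination shape `hdom` of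
`FluxFourier.eblind_of_fluxDomination` (whose constant would carry `e^{E_ψ r}`, crit-3 l.1566).  The adapter below turns flux
suppression + equipartition of the denominators into the EBLIND cross difference, by finite Fourier inversion. -/

section FluxSuppression

variable {α : Type*} [AddCommGroup α] [Fintype α] [DecidableEq α]

/-- **Finite Fourier inversion for functions**: `|α| · W x = Σ_ψ ψ(x) Σ_b ψ(−b) W b`. -/
theorem card_mul_eq_sum_char (W : α → ℂ) (x : α) :
    (Fintype.card α : ℂ) * W x = ∑ ψ : AddChar α ℂ, ψ x * ∑ b : α, ψ (-b) * W b := by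
  have hstep : ∀ ψ : AddChar α ℂ, ψ x * ∑ b : α, ψ (-b) * W b = ∑ b : α, ψ (x - b) * W b := by
    intro ψ
    rw [Finset.mul_sum]
    refine Finset.sum_congr rfl fun b _ => ?_
    rw [← mul_assoc, sub_eq_add_neg, AddChar.map_add_eq_mul]
  simp_rw [hstep]
  rw [Finset.sum_comm]
  simp_rw [← Finset.sum_mul]
  have hite : ∀ b : α, (∑ ψ : AddChar α ℂ, ψ (x - b)) * W b = if x = b then (Fintype.card α : ℂ) * W b else 0 := by
    intro b
    rw [AddChar.sum_apply_eq_ite]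
    by_cases h : x = b
    · subst h
      simp
    · have h' : x - b ≠ 0 := sub_ne_zero.mpr h
      simp [h, h']
  simp_rw [hite, Finset.sum_ite_eq, Finset.mem_univ, if_true]

/-- **Flux suppression ⇒ flux-uniform numerators**: if `‖Σ_b ψ(−b) W b‖ ≤ ε` for every non-trivial character `ψ`, then
`‖W x − W 0‖ ≤ 2ε` for every `x` (`ε ≥ 0`; the trivial character's term cancels; `|ψ(x) − 1| ≤ 2`; `|Γ̂| = |α|`). -/
theorem uniform_of_fluxSuppression (W : α → ℂ) (ε : ℝ) (hε : 0 ≤ ε)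
    (hsup : ∀ ψ : AddChar α ℂ, ψ ≠ 0 → ‖∑ b : α, ψ (-b) * W b‖ ≤ ε) (x : α) : ‖W x - W 0‖ ≤ 2 * ε := by
  have hcpos : (0 : ℝ) < Fintype.card α := Nat.cast_pos.mpr Fintype.card_pos
  have hinv := card_mul_eq_sum_char W x
  have hinv0 := card_mul_eq_sum_char W 0
  have hdiff : (Fintype.card α : ℂ) * (W x - W 0)
      = ∑ ψ : AddChar α ℂ, (ψ x - 1) * ∑ b : α, ψ (-b) * W b := by
    rw [mul_sub, hinv, hinv0, ← Finset.sum_sub_distrib]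
    refine Finset.sum_congr rfl fun ψ _ => ?_
    rw [AddChar.map_zero_eq_one, sub_mul, one_mul]
  have hnorm : (Fintype.card α : ℝ) * ‖W x - W 0‖ ≤ (Fintype.card α : ℝ) * (2 * ε) := by
    have h1 : (Fintype.card α : ℝ) * ‖W x - W 0‖ = ‖(Fintype.card α : ℂ) * (W x - W 0)‖ := by
      rw [norm_mul, Complex.norm_natCast]
    rw [h1, hdiff]
    calc ‖∑ ψ : AddChar α ℂ, (ψ x - 1) * ∑ b : α, ψ (-b) * W b‖
        ≤ ∑ ψ : AddChar α ℂ, ‖(ψ x - 1) * ∑ b : α, ψ (-b) * W b‖ := norm_sum_le _ _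
      _ ≤ ∑ ψ : AddChar α ℂ, 2 * ε := by
          refine Finset.sum_le_sum fun ψ _ => ?_
          by_cases hψ : ψ = 0
          · subst hψ
            simp only [AddChar.zero_apply, sub_self, zero_mul, norm_zero]
            positivity
          · rw [norm_mul]
            have h1 : ‖ψ x - 1‖ ≤ 2 := by
              calc ‖ψ x - 1‖ ≤ ‖ψ x‖ + ‖(1 : ℂ)‖ := norm_sub_le _ _
                _ = 2 := by rw [AddChar.norm_apply, norm_one]; norm_num
            exact mul_le_mul h1 (hsup ψ hψ) (norm_nonneg _) (by norm_num)
      _ = (Fintype.card α : ℝ) * (2 * ε) := by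
          rw [Finset.sum_const, Finset.card_univ, AddChar.card_eq, nsmul_eq_mul]
  exact le_of_mul_le_mul_left hnorm hcpos

/-- **★ EBLIND from flux suppression (route (H) consumer).**  Numerators `W` with suppressed non-trivial fluxes
(`‖Σ_b ψ(−b) W b‖ ≤ ε`, `ψ ≠ 0`) and `‖W 0‖ ≤ w`; denominators `Z` equipartitioned around the real `Z₀ ≥ 0`
(`‖Z x − Z₀‖ ≤ δ Z₀`).  Then `‖W x Z y − W y Z x‖ ≤ 4ε(1+δ)Z₀ + 2wδZ₀`.  Reading: `ε = e^{r} C ‖A‖_∞ · δ · Z_t`,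
`w = ‖A‖_∞ Z_t`, `Z₀ = Z_t`: the cross difference is `O(‖A‖_∞ C δ Z_t²)` — rate preserved, constant `e^{r}`-type. -/
theorem eblind_of_fluxSuppression (W Z : α → ℂ) (Z₀ ε w δ : ℝ) (hZ₀ : 0 ≤ Z₀) (hε : 0 ≤ ε)
    (hsup : ∀ ψ : AddChar α ℂ, ψ ≠ 0 → ‖∑ b : α, ψ (-b) * W b‖ ≤ ε) (hw : ‖W 0‖ ≤ w)
    (hZ : ∀ x, ‖Z x - (Z₀ : ℂ)‖ ≤ δ * Z₀) (x y : α) :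
    ‖W x * Z y - W y * Z x‖ ≤ 2 * (2 * ε) * ((1 + δ) * Z₀) + 2 * w * δ * Z₀ :=
  pairBound_of_uniform W Z (W 0) Z₀ (2 * ε) w δ hZ₀ (uniform_of_fluxSuppression W ε hε hsup) hw hZ x y

end FluxSuppression

end Summit.QuantumFields.YangMills.Cruxes.IRcof.EquipartitionSeam.ThickSpecies

end
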